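import Summits.ResolutionOfSingularities.ResolutionOfSingularities.Theorems.WeightedInvariantWeightedThesisProjectiveIntegralSuffices
import Literature.AlgebraicGeometry.Resolution.BlowupsIntegral
import Literature.AlgebraicGeometry.Resolution.BlowupsProperProofs
import Literature.AlgebraicGeometry.Motives.VarietiesProperProofs
import HarnessLib

/-!
# Crux `AffineToGlobal` (stmt-ResolutionOfSingularities-15961), line `birth`: regular blow-ups of
# the integral closed subschemes of projective spaces suffice (the weak-frame reduction)

Route `ResolutionOfSingularities/SectionAscent`, crux `AffineToGlobal`
(`Summit.ResolutionOfSingularities.ResolutionOfSingularities.Theses.SectionAscent.AffineToGlobal`: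
affine `Sing`-exact one-shot resolutions in characteristic `p`, all dimensions ⇒
`ResolutionInChar p`), line `birth`, lead's skeleton `work/AffineToGlobal.lean` (reshape 3).
Support file (`--supports stmt-ResolutionOfSingularities-15961`): the skeleton's stub
`stub_regularBlowupSuffices` PROVED (registered signature verbatim).

**What and why.** The conclusion `ResolutionInChar p` of the crux asks, for every reduced
separated scheme `X` of finite type over a field of characteristic `p`, only for
`Scheme.HasResolution X` — the WEAK existence statement of Kollár 2007, Thm. 3.36: some proper
birational `π : X' → X` with `X'` regular, with NO condition over the regular locus and NO
`Sing`-supported centre. This file records the resulting reduction of the crux in that weak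
frame: it suffices that every INTEGRAL CLOSED subscheme `X ⊆ ℙⁿ_K` (`char K = p`) admits SOME
blowing up `π : X' → X` along a NON-ZERO ideal sheaf with `X'` regular.

**Proof.** A closed subscheme `X` of `ℙⁿ_K` is of finite type over `K` (`ℙⁿ_K → Spec K` is
proper, `Motives.isProper_projectiveSpace`), hence locally Noetherian
(`LocallyOfFiniteType.isLocallyNoetherian`). A blowing up of a locally Noetherian integral scheme
along a non-zero ideal sheaf is proper (Stacks, Tag 02NS, discharged in the tree as
`stacks02NS_holds`) and birational (Stacks, Tag 02ND: the blow-up is integral and `π` is an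
isomorphism off the centre, `stacks02ND_holds`), so with a regular source it is a resolution in
the weak sense (`IsBlowup.isResolution'`). Finally the landed projective reduction
`Theorems.WeightedThesis.ProjectiveIntegralSuffices.stub_projectiveIntegralSuffices`
(irreducible components with the reduced structure, Chow's lemma, projective closure; Cossart–
Piltant 2019, proof of Prop. 4.6, Steps 1–3) turns resolutions of the integral closed subschemes
of the `ℙⁿ_k` into the `ResolutionInChar p` clause.

## Sources

* J. Kollár, *Lectures on Resolution of Singularities*, Ann. of Math. Stud. 166 (2007),
  Thm. 3.36 (weak form: proper birational from a regular scheme) and Ch. 3. [Kollar2007]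
* The Stacks Project, Tag 02ND (Lemma 31.33.9: blowing up an integral scheme in a non-zero ideal
  is integral), Tag 02NS (Lemma 31.32.13: blowing ups in finite-type ideals are proper).
  [StacksProject]
* V. Cossart, O. Piltant, *Resolution of singularities of arithmetical threefolds*, J. Algebra
  529 (2019), Prop. 4.6 (proof, Steps 1–3). [CossartPiltant2019]
-/

noncomputable section

set_option linter.dupNamespace false -- mandated namespace of this single-conjunct summit

open CategoryTheory AlgebraicGeometry Literature.AlgebraicGeometry.Resolution

namespace Summit.ResolutionOfSingularities.ResolutionOfSingularities.Theorems.AffineToGlobal.RegularBlowupSuffices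

/-- **A regular blowing up of an integral closed subscheme of `ℙⁿ_K` along a non-zero ideal sheaf
is a resolution of singularities** (weak form: proper, birational, regular source). The closed
subscheme `X ⊆ ℙⁿ_K` is of finite type over `K` through the proper structure morphism
`ℙⁿ_K → Spec K`, hence locally Noetherian; then `π` is proper (Stacks 02NS, `stacks02NS_holds`)
and birational (Stacks 02ND), i.e. `IsBlowup.isResolution'` applies.
[cite: StacksProject, Tag 02NS and Tag 02ND] -/
theorem isResolution_of_isBlowup (K : Type) [Field K] (n : ℕ) {X' X : Scheme.{0}}
    (ι : X ⟶ (Literature.AlgebraicGeometry.Motives.projectiveSpace n K).left)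
    (hι : IsClosedImmersion ι) (hX : IsIntegral X) {π : X' ⟶ X} {J : X.IdealSheafData}
    (hJ : J ≠ ⊥) (hπ : IsBlowup π J) (hreg : Scheme.IsRegular X') : IsResolution π := by
  haveI := hι
  haveI := hX
  haveI : IsProper (Literature.AlgebraicGeometry.Motives.projectiveSpace n K).hom :=
    Literature.AlgebraicGeometry.Motives.isProper_projectiveSpace n K
  let f : X ⟶ Spec (.of K) := ι ≫ (Literature.AlgebraicGeometry.Motives.projectiveSpace n K).hom
  haveI : LocallyOfFiniteType f := inferInstance
  haveI : IsLocallyNoetherian X := LocallyOfFiniteType.isLocallyNoetherian f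
  exact hπ.isResolution' stacks02NS_holds hJ hreg

/-- **STUB `stub_regularBlowupSuffices` of the birth skeleton, PROVED** (registered signature
verbatim): if every integral closed subscheme of every `ℙⁿ_K`, `char K = p`, admits a blowing up
along a non-zero ideal sheaf with regular source, then `ResolutionInChar p`. Such a blowing up is
proper and birational (`isResolution_of_isBlowup`: Stacks 02NS/02ND, `X` being locally
Noetherian as a closed subscheme of `ℙⁿ_K`), hence a resolution in the weak sense of
Kollár 2007, Thm. 3.36 — which is all `Scheme.HasResolution` asks — and the projective integral
case suffices (`Theorems.WeightedThesis.ProjectiveIntegralSuffices.stub_projectiveIntegralSuffices`).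
[cite: Kollar2007, Thm. 3.36 (weak form); StacksProject, Tag 02ND and Tag 02NS] -/
theorem stub_regularBlowupSuffices (p : ℕ)
    (h : ∀ (K : Type) [Field K] [CharP K p] (n : ℕ) (X : Scheme.{0})
      (ι : X ⟶ (Literature.AlgebraicGeometry.Motives.projectiveSpace n K).left),
      IsClosedImmersion ι → IsIntegral X →
      ∃ (X' : Scheme.{0}) (π : X' ⟶ X) (J : X.IdealSheafData),
        J ≠ ⊥ ∧ IsBlowup π J ∧ Scheme.IsRegular X') :
    ResolutionInChar.{0} p := by
  intro k _ _ X f hsep hlft hqc hred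
  refine Theorems.WeightedThesis.ProjectiveIntegralSuffices.stub_projectiveIntegralSuffices k
    (fun n Y ι hι hint => ?_) X f hsep hlft hqc hred
  obtain ⟨Y', π, J, hJ, hπ, hreg⟩ := h k n Y ι hι hint
  exact ⟨Y', π, isResolution_of_isBlowup k n ι hι hint hJ hπ hreg⟩

end Summit.ResolutionOfSingularities.ResolutionOfSingularities.Theorems.AffineToGlobal.RegularBlowupSuffices

end
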